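import Mathlib
import HarnessLib
import Literature.Analysis.FluidPDE.NewtonKernel
import Literature.Analysis.FluidPDE.SelfSimilarEulerOutgoingFlatVorticity
import Literature.Analysis.FluidPDE.LandauSolutions
import Literature.Analysis.FluidPDE.SverakLandauClassificationProofs
import Summits.NavierStokesRegularity.NavierStokesRegularity.Theorems.TypeIQuarterGateScarEnvelopeTypeIForcedTsaiTailDichotomyShells

/-!
# ARM B — REGISTERED TAIL DICHOTOMY, part 3 (`…ForcedTsaiTailDichotomy`): the exactly homogeneous far field solves the STEADY
  NAVIER–STOKES system off the origin and is therefore a LANDAU solution or zero (Šverák 2011)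
  (ns-wall-extremal; (C2) of LINEAR-FLOOR §3 / DATUM B-2k as an unconditional kernel theorem)

Cell ns-wall-extremal, seat ns-wall-eng-1 g7.  Parts 1–2 (`…HomogeneousTailScaling`, `…TailDichotomyShells`) gave: for `U ∈ C³` coinciding outside a ball
with an exactly `(−1)`-homogeneous `V` and with integrable registered weighted residual, `g_U ≡ 0`
outside the ball, where `g_U = curl G_V`, `G_V = −ΔV + (V·∇)V` the (unconditionally
`(−3)`-homogeneous) steady residual.  Here:

* `hasGradientAt_inner_steadyResidual`, `gradient_pressure_eq` — a curl-free `(−3)`-homogeneous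
  field is an EXPLICIT gradient: `∇⟪G_V, y⟫ = DG_Vᵀy + G_V = DG_V y + G_V = −3G_V + G_V = −2G_V`
  (symmetry of `DG_V` from `curl G_V = 0`, tree `isSymmetric_fderiv_of_curl_eq_zero`; Euler's
  identity, p688729), so `P := ½⟪G_V, y⟫` has `∇P = −G_V`;
* ★★ `steadyNS_of_homogeneousTail_exterior` / `steadyNS_of_homogeneousTail` — `(V·∇)V + ∇P = ΔV`
  outside the ball, and then on ALL of `ℝ³ ∖ {0}` (the identity is transported inward by the
  unconditional scaling of `G_V` and `∇P`); `divergence_eq_zero_of_homogeneousTail`;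
* smoothness off the origin: `contDiffAt_steadyResidual_of_homogeneousTail`,
  `contDiffOn_pressure_of_homogeneousTail` (near each `x ≠ 0`, `V` is the NS-rescaling `c • U(c ·)`
  of the smooth `U`);
* ★★★ `landau_or_zero_of_homogeneousTail` — **UNCONDITIONAL**: for `U ∈ C^∞` divergence free with
  the integrability conjunct of the registered currency and an exactly `(−1)`-homogeneous far field
  `V` (`U = V` on `{ρ < ‖y‖}`, `ρ ≥ 0`): either `V = 0` on `ℝ³ ∖ {0}`, or
  `V x = R (landauSolution 1 A (R⁻¹ x))` (`x ≠ 0`) for a linear isometry `R` and `A > 1` — by the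
  tree's PROVED fact `Sverak2011_landauClassification_holds` (`.of_profile_frame`).

With `…ForcedTsaiLandauTail` (p702146: Landau tails have zero exterior registered residual) the
admissible exactly `(−1)`-homogeneous far fields of the registered currency are PRECISELY the Landau
fields and `0`; the Stokeslet (p694942) and swirl-tail (p698489) obstructions are instances.

HONEST FRAME.  Structural helper about the registered CURRENCY (`--supports
stmt-NavierStokesRegularity-23843`); excludes no near-profile whose tail is not EXACTLY homogeneous,
bounds no modulus, changes no number of record.  Crux `ScarEnvelopeTypeI` (stmt-23843) / wall H3
OPEN; NS regularity NOT proved.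
-/

noncomputable section

set_option linter.dupNamespace false

namespace Summit.NavierStokesRegularity.NavierStokesRegularity.Cruxes.ScarEnvelopeTypeI.ForcedTsai

open MeasureTheory Set Metric Filter Topology
open scoped ContDiff Laplacian InnerProductSpace RealInnerProductSpace Pointwise
open Literature.Analysis.FluidPDE

namespace TailDichotomy

variable {V U : E3 → E3} {ρ : ℝ}
/-! ## Part 3 — the homogeneous far field solves the STEADY NAVIER–STOKES system off the origin -/

section SteadyNS

/-- Euler's identity for the `(−3)`-homogeneous steady residual: `DG_V(y)[y] = −3 G_V(y)` wherever
`G_V` is differentiable. -/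
theorem fderiv_steadyResidual_apply_self
    (hV : ∀ c : ℝ, 0 < c → ∀ y : E3, V (c • y) = c⁻¹ • V y) {y : E3}
    (hd : DifferentiableAt ℝ (fun z : E3 => -((Δ V) z) + convect V V z) y) :
    fderiv ℝ (fun z : E3 => -((Δ V) z) + convect V V z) y y
      = ((-3 : ℤ) : ℝ) • (-((Δ V) y) + convect V V y) := by
  refine fderiv_apply_self_of_homogeneous (U := fun z : E3 => -((Δ V) z) + convect V V z)
    (-3) (fun t ht => ?_) hd
  rw [steadyResidual_smul' hV ht y, show ((-3 : ℤ)) = -((3 : ℕ) : ℤ) by norm_num, zpow_neg,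
    zpow_natCast]

/-- **A curl-free `(−3)`-homogeneous field is a gradient, explicitly**: if `G_V` is differentiable
at `y` with `curl G_V (y) = 0`, then `Q(z) := ⟪G_V(z), z⟫` has gradient `−2 G_V(y)` at `y`
(`∇⟪G,z⟫ = DGᵀz + G = DG z + G = −3G + G`, using the symmetry of `DG` from `curl G = 0`). -/
theorem hasGradientAt_inner_steadyResidual
    (hV : ∀ c : ℝ, 0 < c → ∀ y : E3, V (c • y) = c⁻¹ • V y) {y : E3}
    (hd : DifferentiableAt ℝ (fun z : E3 => -((Δ V) z) + convect V V z) y)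
    (hcurl : curl (fun z : E3 => -((Δ V) z) + convect V V z) y = 0) :
    HasGradientAt (fun z : E3 => ⟪-((Δ V) z) + convect V V z, z⟫)
      ((-2 : ℝ) • (-((Δ V) y) + convect V V y)) y := by
  set G : E3 → E3 := fun z : E3 => -((Δ V) z) + convect V V z with hG
  have h1 : HasFDerivAt (fun z : E3 => ⟪G z, z⟫)
      ((fderivInnerCLM ℝ (G y, y)).comp ((fderiv ℝ G y).prod (ContinuousLinearMap.id ℝ E3))) y :=
    hd.hasFDerivAt.inner ℝ (hasFDerivAt_id y)
  have hsymm := isSymmetric_fderiv_of_curl_eq_zero hd hcurl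
  have heuler : fderiv ℝ G y y = ((-3 : ℤ) : ℝ) • G y := fderiv_steadyResidual_apply_self hV hd
  rw [hasGradientAt_iff_hasFDerivAt]
  refine h1.congr_fderiv ?_
  ext h
  rw [InnerProductSpace.toDual_apply_apply, ContinuousLinearMap.comp_apply,
    ContinuousLinearMap.prod_apply, fderivInnerCLM_apply, ContinuousLinearMap.id_apply]
  -- `⟪DG h, y⟫ = ⟪h, DG y⟫ = −3⟪h, G y⟫`
  have hs : ⟪fderiv ℝ G y h, y⟫ = ⟪h, fderiv ℝ G y y⟫ := hsymm h y
  simp only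
  rw [hs, heuler, real_inner_smul_left, real_inner_smul_right, real_inner_comm (G y) h]
  push_cast
  ring

/-- **The pressure of the far field.**  With `P(z) := ½⟪G_V(z), z⟫` one has `∇P(y) = −G_V(y)`
wherever `G_V` is differentiable and curl free. -/
theorem gradient_pressure_eq
    (hV : ∀ c : ℝ, 0 < c → ∀ y : E3, V (c • y) = c⁻¹ • V y) {y : E3}
    (hd : DifferentiableAt ℝ (fun z : E3 => -((Δ V) z) + convect V V z) y)
    (hcurl : curl (fun z : E3 => -((Δ V) z) + convect V V z) y = 0) :
    gradient (fun z : E3 => (1 / 2 : ℝ) * ⟪-((Δ V) z) + convect V V z, z⟫) y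
      = -(-((Δ V) y) + convect V V y) := by
  have hQ := (hasGradientAt_inner_steadyResidual hV hd hcurl)
  rw [hasGradientAt_iff_hasFDerivAt] at hQ
  have hP : HasFDerivAt (fun z : E3 => (1 / 2 : ℝ) * ⟪-((Δ V) z) + convect V V z, z⟫)
      ((1 / 2 : ℝ) • InnerProductSpace.toDual ℝ E3 ((-2 : ℝ) • (-((Δ V) y) + convect V V y))) y :=
    hQ.const_mul (1 / 2 : ℝ)
  have hP' : HasGradientAt (fun z : E3 => (1 / 2 : ℝ) * ⟪-((Δ V) z) + convect V V z, z⟫)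
      (-(-((Δ V) y) + convect V V y)) y := by
    rw [hasGradientAt_iff_hasFDerivAt]
    refine hP.congr_fderiv ?_
    rw [← map_smul, smul_smul, show (1 / 2 : ℝ) * -2 = -1 by norm_num, neg_one_smul]
  exact hP'.gradient

/-- Outside the ball the steady residual `G_V` is differentiable (it agrees near every exterior point
with the `C¹` registered momentum residual of `U ∈ C³`). -/
theorem differentiableAt_steadyResidual_of_tail (hU3 : ContDiff ℝ 3 U)
    (hV : ∀ c : ℝ, 0 < c → ∀ y : E3, V (c • y) = c⁻¹ • V y)
    (hU : ∀ y : E3, ρ < ‖y‖ → U y = V y) {x : E3} (hx : ρ < ‖x‖) :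
    DifferentiableAt ℝ (fun z : E3 => -((Δ V) z) + convect V V z) x := by
  have hU1 : ContDiff ℝ 1 U := hU3.of_le (by norm_num)
  have hloc := lerayMomentumResidual_eventuallyEq_steadyResidual hU1 hV hU hx
  have hd : DifferentiableAt ℝ (lerayMomentumResidual U) x :=
    ((LandauTail.contDiff_one_lerayMomentumResidual hU3).differentiable one_ne_zero) x
  exact hloc.differentiableAt_iff.mp hd

/-- ★★ **REGISTERED TAIL DICHOTOMY, structure half (exterior form).**  Under the hypotheses of
`lerayVorticityResidual_eq_zero_of_homogeneousTail`, the homogeneous far field `V` solves the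
STEADY NAVIER–STOKES SYSTEM outside the ball with the explicit `(−2)`-homogeneous pressure
`P := ½⟪−ΔV + (V·∇)V, y⟫`:  `(V·∇)V + ∇P = ΔV` on `{ρ < ‖y‖}`. -/
theorem steadyNS_of_homogeneousTail_exterior (hU3 : ContDiff ℝ 3 U)
    (hV : ∀ c : ℝ, 0 < c → ∀ y : E3, V (c • y) = c⁻¹ • V y) (hρ : 0 ≤ ρ)
    (hU : ∀ y : E3, ρ < ‖y‖ → U y = V y)
    (hint : Integrable (fun y : E3 => (1 + ‖y‖) ^ 5 * ‖lerayVorticityResidual U y‖ ^ 2))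
    {y : E3} (hy : ρ < ‖y‖) :
    convect V V y + gradient (fun z : E3 => (1 / 2 : ℝ) * ⟪-((Δ V) z) + convect V V z, z⟫) y
      = (Δ V) y := by
  have hU1 : ContDiff ℝ 1 U := hU3.of_le (by norm_num)
  have hd := differentiableAt_steadyResidual_of_tail hU3 hV hU hy
  have hcurl : curl (fun z : E3 => -((Δ V) z) + convect V V z) y = 0 := by
    rw [← lerayVorticityResidual_eq_curl_steadyResidual hU1 hV hU hy]
    exact lerayVorticityResidual_eq_zero_of_homogeneousTail hU3 hV hρ hU hint hy
  rw [gradient_pressure_eq hV hd hcurl]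
  abel

/-- The pressure `P = ½⟪G_V, y⟫` is `(−2)`-homogeneous, unconditionally:
`c² P(c x) = P(x)` as the rescaling identity `(fun y => c² P(c y)) = P`. -/
theorem pressure_rescale_eq (hV : ∀ c : ℝ, 0 < c → ∀ y : E3, V (c • y) = c⁻¹ • V y) {c : ℝ}
    (hc : 0 < c) :
    (fun y : E3 => c ^ 2 * (fun z : E3 => (1 / 2 : ℝ) * ⟪-((Δ V) z) + convect V V z, z⟫) (c • y))
      = fun z : E3 => (1 / 2 : ℝ) * ⟪-((Δ V) z) + convect V V z, z⟫ := by
  funext y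
  simp only
  rw [steadyResidual_smul' hV hc y, real_inner_smul_left, real_inner_smul_right]
  field_simp

/-- Gradient of a rescaled scalar: `∇(k P(c ·))(x) = (k c) • ∇P(c x)` (no differentiability
hypothesis; local copy of a two-line tree lemma to keep the imports light). -/
theorem gradient_const_mul_comp_smul' (P : E3 → ℝ) (k c : ℝ) (x : E3) :
    gradient (fun y => k * P (c • y)) x = (k * c) • gradient P (c • x) := by
  have h : (fun y => k * P (c • y)) = fun y => k • P (c • y) := rfl
  rw [h, gradient, fderiv_const_smul_comp_smul' P k c x, map_smul, gradient]

/-- The pressure gradient is `(−3)`-homogeneous, unconditionally: `∇P(x) = c³ • ∇P(c x)`. -/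
theorem gradient_pressure_smul (hV : ∀ c : ℝ, 0 < c → ∀ y : E3, V (c • y) = c⁻¹ • V y)
    {c : ℝ} (hc : 0 < c) (x : E3) :
    gradient (fun z : E3 => (1 / 2 : ℝ) * ⟪-((Δ V) z) + convect V V z, z⟫) x
      = c ^ 3 • gradient (fun z : E3 => (1 / 2 : ℝ) * ⟪-((Δ V) z) + convect V V z, z⟫) (c • x) := by
  have h := gradient_const_mul_comp_smul'
    (fun z : E3 => (1 / 2 : ℝ) * ⟪-((Δ V) z) + convect V V z, z⟫) (c ^ 2) c x
  rw [pressure_rescale_eq hV hc] at h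
  rw [h, show c ^ 2 * c = c ^ 3 by ring]

/-- ★★ **REGISTERED TAIL DICHOTOMY, structure half (punctured space).**  Under the same hypotheses
the far field solves the steady Navier–Stokes system on ALL of `ℝ³ ∖ {0}` (homogeneity transports
the exterior identity inward): `(V·∇)V + ∇P = ΔV` for every `x ≠ 0`. -/
theorem steadyNS_of_homogeneousTail (hU3 : ContDiff ℝ 3 U)
    (hV : ∀ c : ℝ, 0 < c → ∀ y : E3, V (c • y) = c⁻¹ • V y) (hρ : 0 ≤ ρ)
    (hU : ∀ y : E3, ρ < ‖y‖ → U y = V y)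
    (hint : Integrable (fun y : E3 => (1 + ‖y‖) ^ 5 * ‖lerayVorticityResidual U y‖ ^ 2))
    {x : E3} (hx : x ≠ 0) :
    convect V V x + gradient (fun z : E3 => (1 / 2 : ℝ) * ⟪-((Δ V) z) + convect V V z, z⟫) x
      = (Δ V) x := by
  -- rescale to an exterior point `c • x`
  have hxn : 0 < ‖x‖ := norm_pos_iff.mpr hx
  set c : ℝ := (ρ + 1) / ‖x‖ with hc_def
  have hc : 0 < c := div_pos (by linarith) hxn
  have hcx : ρ < ‖c • x‖ := by
    rw [norm_smul, Real.norm_of_nonneg hc.le, hc_def, div_mul_cancel₀ _ hxn.ne']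
    linarith
  have hext := steadyNS_of_homogeneousTail_exterior hU3 hV hρ hU hint hcx
  -- `G_V(x) + ∇P(x) = c³ • (G_V(c x) + ∇P(c x)) = 0`
  have hG := steadyResidual_smul hV hc x
  have hP := gradient_pressure_smul hV hc x
  have key : -((Δ V) x) + convect V V x
      + gradient (fun z : E3 => (1 / 2 : ℝ) * ⟪-((Δ V) z) + convect V V z, z⟫) x = 0 := by
    rw [← hG, hP, ← smul_add]
    have h0 : -((Δ V) (c • x)) + convect V V (c • x)
        + gradient (fun z : E3 => (1 / 2 : ℝ) * ⟪-((Δ V) z) + convect V V z, z⟫) (c • x) = 0 := by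
      rw [← hext]; abel
    rw [h0, smul_zero]
  rw [← sub_eq_zero]
  rw [← key]
  abel

/-- **The far field is divergence free on `ℝ³ ∖ {0}`** if `U` is (locality outside the ball,
homogeneity inside). -/
theorem divergence_eq_zero_of_homogeneousTail (hU1 : ContDiff ℝ 1 U)
    (hdiv : VectorCalculus.IsDivFree U)
    (hV : ∀ c : ℝ, 0 < c → ∀ y : E3, V (c • y) = c⁻¹ • V y) (hρ : 0 ≤ ρ)
    (hU : ∀ y : E3, ρ < ‖y‖ → U y = V y) {x : E3} (hx : x ≠ 0) :
    VectorCalculus.divergence V x = 0 := by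
  have hext : ∀ y : E3, ρ < ‖y‖ → VectorCalculus.divergence V y = 0 := by
    intro y hy
    rw [VectorCalculus.divergence, ← (eventuallyEq_of_tail hU hy).fderiv_eq, ← VectorCalculus.divergence]
    exact hdiv y
  have hxn : 0 < ‖x‖ := norm_pos_iff.mpr hx
  set c : ℝ := (ρ + 1) / ‖x‖ with hc_def
  have hc : 0 < c := div_pos (by linarith) hxn
  have hcx : ρ < ‖c • x‖ := by
    rw [norm_smul, Real.norm_of_nonneg hc.le, hc_def, div_mul_cancel₀ _ hxn.ne']
    linarith
  have _ := hU1
  rw [divergence_smul_of_homogeneous hV hc x, hext _ hcx, mul_zero]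

end SteadyNS

/-! ## Part 4 — ŠVERÁK: the far field is a LANDAU solution (or zero) -/

section Landau

/-- The steady residual of a GLOBAL smooth field is smooth. -/
theorem contDiff_steadyResidual {W : E3 → E3} (hW : ContDiff ℝ ∞ W) :
    ContDiff ℝ ∞ (fun z : E3 => -((Δ W) z) + convect W W z) := by
  have hΔ : ContDiff ℝ ∞ (Δ W) :=
    contDiff_infty.2 fun n => contDiff_laplacian (n := n) (contDiff_infty.1 hW (n + 2))
  have hD : ContDiff ℝ ∞ (fderiv ℝ W) := hW.fderiv_right (m := ∞) (by simp)
  have hN : ContDiff ℝ ∞ (fun z : E3 => fderiv ℝ W z (W z)) := hD.clm_apply hW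
  exact hΔ.neg.add hN

/-- Locality of the steady residual: fields agreeing near `x` have the same `−ΔW + (W·∇)W` at `x`. -/
theorem steadyResidual_congr {W W' : E3 → E3} {x : E3} (h : W =ᶠ[𝓝 x] W') :
    -((Δ W) x) + convect W W x = -((Δ W') x) + convect W' W' x := by
  rw [convect, convect, (InnerProductSpace.laplacian_congr_nhds h).eq_of_nhds, h.fderiv_eq,
    h.eq_of_nhds]

/-- Near every `x ≠ 0` the steady residual `G_V` of the homogeneous tail of `U ∈ C^∞` agrees with the
steady residual of a GLOBAL smooth field (the Navier–Stokes rescaling `c • U(c ·)`), hence is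
smooth at `x` (`ρ ≥ 0`). -/
theorem contDiffAt_steadyResidual_of_homogeneousTail (hUs : ContDiff ℝ ∞ U)
    (hV : ∀ c : ℝ, 0 < c → ∀ y : E3, V (c • y) = c⁻¹ • V y) (hρ : 0 ≤ ρ)
    (hU : ∀ y : E3, ρ < ‖y‖ → U y = V y) {x : E3} (hx : x ≠ 0) :
    ContDiffAt ℝ ∞ (fun z : E3 => -((Δ V) z) + convect V V z) x := by
  have hxn : 0 < ‖x‖ := norm_pos_iff.mpr hx
  set c : ℝ := (ρ + 1) / ‖x‖ with hc_def
  have hc : 0 < c := div_pos (by linarith) hxn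
  have hcx : ρ < c * ‖x‖ := by
    rw [hc_def, div_mul_cancel₀ _ hxn.ne']
    linarith
  set W : E3 → E3 := fun y : E3 => c • U (c • y) with hW_def
  have hW : ContDiff ℝ ∞ W := (hUs.comp (contDiff_const_smul c)).const_smul c
  -- `V = W` on the open set `{ρ < c‖y‖} ∋ x`, hence the residuals agree near `x`
  have hopen : IsOpen {y : E3 | ρ < c * ‖y‖} :=
    isOpen_lt continuous_const (continuous_const.mul continuous_norm)
  have hloc : (fun z : E3 => -((Δ V) z) + convect V V z)
      =ᶠ[𝓝 x] fun z : E3 => -((Δ W) z) + convect W W z := by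
    refine Filter.eventually_of_mem (hopen.mem_nhds hcx) fun y hy => ?_
    exact steadyResidual_congr (eventuallyEq_rescale_of_homogeneousTail hV hU hc hy)
  exact ((contDiff_steadyResidual hW).contDiffAt).congr_of_eventuallyEq hloc

/-- The pressure `P = ½⟪G_V, y⟫` is smooth on `ℝ³ ∖ {0}` (for `U ∈ C^∞`, `ρ ≥ 0`). -/
theorem contDiffOn_pressure_of_homogeneousTail (hUs : ContDiff ℝ ∞ U)
    (hV : ∀ c : ℝ, 0 < c → ∀ y : E3, V (c • y) = c⁻¹ • V y) (hρ : 0 ≤ ρ)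
    (hU : ∀ y : E3, ρ < ‖y‖ → U y = V y) :
    ContDiffOn ℝ ∞ (fun z : E3 => (1 / 2 : ℝ) * ⟪-((Δ V) z) + convect V V z, z⟫) {0}ᶜ := by
  intro x hx
  have hG := contDiffAt_steadyResidual_of_homogeneousTail hUs hV hρ hU hx
  exact (contDiffAt_const.mul (hG.inner ℝ contDiffAt_id)).contDiffWithinAt

/-- ★★★ **REGISTERED TAIL DICHOTOMY (Landau form, UNCONDITIONAL).**  Let `U : ℝ³ → ℝ³` be smooth
and divergence free, with the INTEGRABILITY conjunct of the registered currency
(`(1+‖y‖)⁵‖g_U‖²` integrable), and suppose that outside a closed ball `U` coincides with an EXACTLY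
`(−1)`-homogeneous field `V` (`U = V` on `{ρ < ‖y‖}`, `ρ ≥ 0`).  Then EITHER `V` vanishes on
`ℝ³ ∖ {0}`, OR `V` is a LANDAU solution (viscosity `1`) in some orthonormal frame: there are a linear
isometry `R` and `A > 1` with `V x = R (landauSolution 1 A (R⁻¹ x))` for all `x ≠ 0`.
(Šverák 2011, Thm 1 — the tree's PROVED fact `Sverak2011_landauClassification_holds` — applied to
the steady system delivered by `steadyNS_of_homogeneousTail`.)  With `…ForcedTsaiLandauTail`
(p702146: Landau tails DO have zero exterior residual) this is an IFF at the level of exactly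
homogeneous tails: the admissible exactly `(−1)`-homogeneous far fields of the registered currency
are precisely the Landau fields and `0` — (C2) of LINEAR-FLOOR §3 as a theorem; the Stokeslet
(p694942) and swirl-tail (p698489) obstructions are instances. -/
theorem landau_or_zero_of_homogeneousTail (hUs : ContDiff ℝ ∞ U)
    (hdiv : VectorCalculus.IsDivFree U)
    (hV : ∀ c : ℝ, 0 < c → ∀ y : E3, V (c • y) = c⁻¹ • V y) (hρ : 0 ≤ ρ)
    (hU : ∀ y : E3, ρ < ‖y‖ → U y = V y)
    (hint : Integrable (fun y : E3 => (1 + ‖y‖) ^ 5 * ‖lerayVorticityResidual U y‖ ^ 2)) :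
    (∀ x : E3, x ≠ 0 → V x = 0) ∨
      ∃ (R : E3 ≃ₗᵢ[ℝ] E3) (A : ℝ), 1 < A ∧
        ∀ x : E3, x ≠ 0 → V x = R (landauSolution 1 A (R.symm x)) := by
  by_cases hne : ∃ x : E3, V x ≠ 0
  · right
    have hU3 : ContDiff ℝ 3 U := hUs.of_le (by norm_cast)
    have hU1 : ContDiff ℝ 1 U := hUs.of_le (by norm_cast)
    have hVs : ContDiffOn ℝ ∞ V {0}ᶜ := contDiffOn_of_homogeneousTail hUs hV hρ hU
    have hPs := contDiffOn_pressure_of_homogeneousTail hUs hV hρ hU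
    have hmom : ∀ x : E3, x ≠ 0 →
        convect V V x + gradient (fun z : E3 => (1 / 2 : ℝ) * ⟪-((Δ V) z) + convect V V z, z⟫) x
          = (1 : ℝ) • (Δ V) x := by
      intro x hx
      rw [one_smul]
      exact steadyNS_of_homogeneousTail hU3 hV hρ hU hint hx
    have hdivV : ∀ x : E3, x ≠ 0 → VectorCalculus.divergence V x = 0 :=
      fun x hx => divergence_eq_zero_of_homogeneousTail hU1 hdiv hV hρ hU hx
    exact Sverak2011_landauClassification_holds.of_profile_frame one_pos hVs hPs hmom hdivV hV hne
  · left
    push Not at hne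
    exact fun x _ => hne x

end Landau


end TailDichotomy

end Summit.NavierStokesRegularity.NavierStokesRegularity.Cruxes.ScarEnvelopeTypeI.ForcedTsai

end
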